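import Summits.ResolutionOfSingularities.ResolutionOfSingularities.Theorems.FrobeniusClosingSteerRadicandSingularCriterion
import Summits.ResolutionOfSingularities.ResolutionOfSingularities.Theorems.FrobeniusClosingSteerAutoPermissibleTwo
import Literature.AlgebraicGeometry.Resolution.RsopMonomialIdeals
import Literature.AlgebraicGeometry.Resolution.RsopLocalization
import Mathlib.RingTheory.Derivation.Basic
import Mathlib.RingTheory.Ideal.Height
import Mathlib.Algebra.CharP.Subring
import HarnessLib

/-!
# Crux `Steer` (stmt-ResolutionOfSingularities-16345), chain W4.1, p = 2 σ-residual, LOW half: the CRITICAL SURFACE of an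
# order-2 radicand — Jacobian ideal in every singular prime (C1) and the Jacobian pair is part of a regular system of
# parameters cutting out a regular surface germ (C2) (Theses-free, def-free)

OURS (campaign `res-hironaka`, rung L ★L-G4, slot W4.1; holder of record res-L0-w41-lead-1 g4 on res-L0-w41-idea-3 g2's card
`hyperbolic-splitting-p2` v2, `L/res-L0-w41-idea-3/Sketch.lean` d722dca222cbcc1c §4 — the STATICS C1 `JacobianInSingularPrime` and C2
`CriticalSurface`; replaces the role of no printed item; NOT a statement of the manuscript under review [claim: Hironaka2017, status:
under-review]; AI review is weaker than expert review).

Setting (idea-3 §4): `(R, 𝔪)` a regular local ring of characteristic `2`, `f ∈ R` the radicand of the torsor `T² = f`. At `p = 2`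
cleaning subtracts SQUARES and squares have zero differential (`D (g²) = 2 g D g = 0`), so the Jacobian ideal of `f` is
cleaning-invariant.

* **(C1) `CriticalSurface.derivation_apply_mem_of_singular`** — if `T² = f` is SINGULAR at the prime `Q` (the W4.1 vocabulary
  `IsSingPrime R 2 f Q` = idea-3's `SingAt f Q`, UNFOLDED as in res-type-082's files: the torsor over `Localization.AtPrime Q` is not
  a regular local ring) then `D f ∈ Q` for EVERY derivation `D` of `R`. Proof without extending `D` to `R_Q`: by 082's criterion
  (`RadicandSingular.not_isRegularLocalRing_adjoinRoot_atPrime_iff`, p503226) `f − γ² ∈ 𝔪_Q²` for some `γ = a/s ∈ R_Q`, so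
  `u · (s² f − a²) ∈ Q²` for some `u ∉ Q`; derivations map `Q²` into `Q` and kill squares in characteristic `2`, whence
  `D u · (s² f − a²) + u s² · D f ∈ Q`, and `s² f − a² ∈ Q`, `u, s ∉ Q` give `D f ∈ Q`.
* **(C2) `CriticalSurface.span_jacobianPair_eq_maximalIdeal`** — in LOW SHAPE `f − g² = l₁ l₂ + c`, `c ∈ 𝔪³`, `(l₁, l₂, l₃, l₄)`
  generating `𝔪`, with derivations `D₁, D₂` DUAL to `l₁, l₂`, the JACOBIAN PAIR `e₁ := D₁ f = l₂ + D₁ c`, `e₂ := D₂ f = l₁ + D₂ c`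
  (`D c ∈ 𝔪²`) satisfies `(e₁, e₂, l₃, l₄) = 𝔪` (Nakayama). **`CriticalSurface.isRsopPart_jacobianPair`** /
  **`eq_span_jacobianPair_of_height_le_two`** — if moreover `dim R = 4` (the chain's members: res-type-071 K-T1 p503921), the pair
  `(e₁, e₂)` is part of a regular system of parameters (`IsRsopPart`), `P₀ := (e₁, e₂)` is a prime of height `2` with `R ⧸ P₀`
  regular — the CRITICAL SURFACE germ Σ₂ — and every prime `Q ∋ e₁, e₂` of height `≤ 2` equals `P₀`. With (C1): every singular
  prime of `T² = f` lies on Σ₂. (idea-3's typed C2 carries no dimension hypothesis; for `dim R < 4` one `lⱼ` may lie in `𝔪²` and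
  the second clause can fail, so the dimension is made explicit here — nothing is lost for the chain.)

Consumers: idea-3's C3 `LowStageDichotomy` / C7 `SingAlongCriticalSurface` and res-L0-w41-strat-2's LOW slate (B8/B9); the LOW
half of the σ-residual `LowOrderTailConclTwo` (skeleton r24 §σ2.15). [cite: Matsumura1987, Thm. 14.2, Thm. 30.6]
[cite: AtiyahMacdonald1969, Prop. 2.6] [folklore]
-/

noncomputable section

-- `Summit.<S>.<S>.…` duplicates the summit name by design (single-problem summit).
set_option linter.dupNamespace false

open Polynomial IsLocalRing

namespace Summit.ResolutionOfSingularities.ResolutionOfSingularities.Theorems.SwitchingDichotomy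

open Literature.AlgebraicGeometry.Resolution

namespace CriticalSurface

universe u

/-! ## (0) Derivations: powers of an ideal, squares in characteristic 2 -/

section Derivations

variable {R : Type u} [CommRing R] (D : Derivation ℤ R R)

/-- A derivation maps `I^(n+1)` into `I^n`. [folklore] -/
theorem derivation_apply_mem_pow (I : Ideal R) :
    ∀ (n : ℕ) {x : R}, x ∈ I ^ (n + 1) → D x ∈ I ^ n
  | 0, x, _ => by simp
  | n + 1, x, hx => by
    rw [pow_succ'] at hx
    refine Submodule.mul_induction_on hx (fun a ha b hb => ?_) (fun a b ha hb => ?_)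
    · rw [D.leibniz, smul_eq_mul, smul_eq_mul]
      refine Ideal.add_mem _ ?_ (Ideal.mul_mem_right _ _ hb)
      rw [pow_succ']
      exact Ideal.mul_mem_mul ha (derivation_apply_mem_pow I n hb)
    · rw [map_add]; exact Ideal.add_mem _ ha hb

/-- A derivation maps `I²` into `I`. [folklore] -/
theorem derivation_apply_mem_of_mem_sq (I : Ideal R) {x : R} (hx : x ∈ I ^ 2) : D x ∈ I := by
  simpa using derivation_apply_mem_pow D I 1 hx

/-- In characteristic `2` a derivation kills squares: `D (y²) = 2 y D y = 0`. [folklore] -/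
theorem derivation_apply_sq [CharP R 2] (y : R) : D (y ^ 2) = 0 := by
  have h2 : (2 : R) = 0 := CharP.cast_eq_zero R 2
  rw [pow_two, D.leibniz, smul_eq_mul, ← two_mul, h2, zero_mul]

end Derivations

/-! ## (C1) The Jacobian ideal lies in every singular prime -/

section JacobianInSingularPrime

variable {K : Type} [Field K] [CharP K 2]

/-- **(C1) The Jacobian ideal lies in every singular prime** (res-L0-w41-idea-3's `JacobianInSingularPrime`, `SingAt` UNFOLDED):
over a regular local subring `R ⊆ K` of characteristic `2`, if the torsor `T² = f` is singular at the prime `Q` then `D f ∈ Q` for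
every derivation `D` of `R`. (Cleaning-invariant: `D (g²) = 0`.) OURS. [cite: Matsumura1987, Thm. 14.2] [folklore] -/
theorem derivation_apply_mem_of_singular (R : Subring K) [IsRegularLocalRing R] (f : R) (Q : Ideal R) [Q.IsPrime]
    (hsing : ¬ IsRegularLocalRing (AdjoinRoot ((X : (Localization.AtPrime Q)[X]) ^ 2 -
      C (algebraMap R (Localization.AtPrime Q) f))))
    (D : Derivation ℤ R R) : D f ∈ Q := by
  classical
  haveI : Fact (2 : ℕ).Prime := ⟨Nat.prime_two⟩
  set L := Localization.AtPrime Q with hL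
  haveI : IsRegularLocalRing L := isRegularLocalRing_localization_atPrime R Q
  haveI : CharP L 2 := AutoPermissible.charP_localization_atPrime (S := R) 2 Q
  obtain ⟨γ, hγ⟩ := (RadicandSingular.not_isRegularLocalRing_adjoinRoot_atPrime_iff 2 Q f).mp hsing
  obtain ⟨⟨a, s⟩, rfl⟩ := IsLocalization.mk'_surjective Q.primeCompl γ
  -- `s² f − a²` maps into `𝔪_L²`
  have h1 : algebraMap R L ((s : R) ^ 2 * f - a ^ 2) ∈ maximalIdeal L ^ 2 := by
    have hs : algebraMap R L ((s : R) ^ 2 * f - a ^ 2) =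
        algebraMap R L ((s : R) ^ 2) * (algebraMap R L f - IsLocalization.mk' L a s ^ 2) := by
      rw [map_sub, map_mul, mul_sub, map_pow, map_pow, ← mul_pow, IsLocalization.mk'_spec' L a s]
    rw [hs]
    exact Ideal.mul_mem_left _ _ hγ
  -- pull back to `R`: `u · (s² f − a²) ∈ Q²` with `u ∉ Q`
  rw [← Localization.AtPrime.map_eq_maximalIdeal, ← Ideal.map_pow,
    IsLocalization.algebraMap_mem_map_algebraMap_iff Q.primeCompl] at h1
  obtain ⟨u, hu, h2⟩ := h1
  have hu' : u ∉ Q := hu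
  have hs' : (s : R) ∉ Q := s.2
  -- apply `D`
  have h3 : D (u * ((s : R) ^ 2 * f - a ^ 2)) ∈ Q := derivation_apply_mem_of_mem_sq D Q h2
  have h4 : D (u * ((s : R) ^ 2 * f - a ^ 2)) = D u * ((s : R) ^ 2 * f - a ^ 2) + u * ((s : R) ^ 2 * D f) := by
    rw [D.leibniz, map_sub, D.leibniz ((s : R) ^ 2) f, derivation_apply_sq, derivation_apply_sq]
    simp only [smul_eq_mul, sub_zero]
    ring
  have h5 : (s : R) ^ 2 * f - a ^ 2 ∈ Q :=
    ((Ideal.IsPrime.mem_or_mem inferInstance (Ideal.pow_le_self two_ne_zero h2)).resolve_left hu')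
  have h6 : u * ((s : R) ^ 2 * D f) ∈ Q := by
    have h := Ideal.sub_mem _ h3 (Ideal.mul_mem_left _ (D u) h5)
    rwa [h4, add_sub_cancel_left] at h
  have h7 : (s : R) ^ 2 * D f ∈ Q := ((Ideal.IsPrime.mem_or_mem inferInstance h6).resolve_left hu')
  rcases Ideal.IsPrime.mem_or_mem inferInstance h7 with h8 | h8
  · exact absurd (Ideal.IsPrime.mem_of_pow_mem inferInstance 2 h8) hs'
  · exact h8

end JacobianInSingularPrime

/-! ## (C2) The Jacobian pair of a low-shape radicand is part of a regular system of parameters -/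

section JacobianPair

variable {R : Type u} [CommRing R] [IsRegularLocalRing R] [CharP R 2]

/-- **(C2, first clause) `(D₁ f, D₂ f, l₃, l₄) = 𝔪`** (res-L0-w41-idea-3's `CriticalSurface` (i)): in low shape `f − g² = l₁ l₂ + c`,
`c ∈ 𝔪³`, `(l₁, l₂, l₃, l₄) = 𝔪`, with `D₁, D₂` dual to `l₁, l₂`, one has `D₁ f = l₂ + D₁ c`, `D₂ f = l₁ + D₂ c` with
`D c ∈ 𝔪²`, so the Jacobian pair together with `l₃, l₄` generates `𝔪` (Nakayama). OURS. [cite: AtiyahMacdonald1969, Prop. 2.6]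
[folklore] -/
theorem span_jacobianPair_eq_maximalIdeal (f g l₁ l₂ l₃ l₄ c : R) (hf : f - g ^ 2 = l₁ * l₂ + c)
    (hc : c ∈ maximalIdeal R ^ 3) (hspan : Ideal.span {l₁, l₂, l₃, l₄} = maximalIdeal R)
    (D₁ D₂ : Derivation ℤ R R) (h11 : D₁ l₁ = 1) (h12 : D₁ l₂ = 0) (h21 : D₂ l₁ = 0) (h22 : D₂ l₂ = 1) :
    Ideal.span {D₁ f, D₂ f, l₃, l₄} = maximalIdeal R := by
  classical
  have hfeq : f = g ^ 2 + l₁ * l₂ + c := by linear_combination hf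
  have he₁ : D₁ f = l₂ + D₁ c := by
    rw [hfeq, map_add, map_add, derivation_apply_sq, D₁.leibniz, h11, h12]; simp
  have he₂ : D₂ f = l₁ + D₂ c := by
    rw [hfeq, map_add, map_add, derivation_apply_sq, D₂.leibniz, h21, h22]; simp
  have hD₁c : D₁ c ∈ maximalIdeal R ^ 2 := derivation_apply_mem_pow D₁ _ 2 hc
  have hD₂c : D₂ c ∈ maximalIdeal R ^ 2 := derivation_apply_mem_pow D₂ _ 2 hc
  have hl : ∀ x ∈ ({l₁, l₂, l₃, l₄} : Set R), x ∈ maximalIdeal R := fun x hx =>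
    hspan ▸ Ideal.subset_span hx
  have hl₁ : l₁ ∈ maximalIdeal R := hl _ (by simp)
  have hl₂ : l₂ ∈ maximalIdeal R := hl _ (by simp)
  have hl₃ : l₃ ∈ maximalIdeal R := hl _ (by simp)
  have hl₄ : l₄ ∈ maximalIdeal R := hl _ (by simp)
  set N : Ideal R := Ideal.span {D₁ f, D₂ f, l₃, l₄} with hN
  have hNle : N ≤ maximalIdeal R := by
    rw [hN, Ideal.span_le]
    simp only [Set.insert_subset_iff, Set.singleton_subset_iff, SetLike.mem_coe]
    refine ⟨?_, ?_, hl₃, hl₄⟩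
    · rw [he₁]; exact Ideal.add_mem _ hl₂ (Ideal.pow_le_self two_ne_zero hD₁c)
    · rw [he₂]; exact Ideal.add_mem _ hl₁ (Ideal.pow_le_self two_ne_zero hD₂c)
  have hmem : ∀ x ∈ ({D₁ f, D₂ f, l₃, l₄} : Set R), x ∈ N := fun x hx => Ideal.subset_span hx
  -- `𝔪 ≤ N + 𝔪²`
  have hgen : Ideal.span {l₁, l₂, l₃, l₄} ≤ N ⊔ maximalIdeal R ^ 2 := by
    rw [Ideal.span_le]
    simp only [Set.insert_subset_iff, Set.singleton_subset_iff, SetLike.mem_coe]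
    refine ⟨?_, ?_, Ideal.mem_sup_left (hmem _ (by simp)), Ideal.mem_sup_left (hmem _ (by simp))⟩
    · have h : l₁ = D₂ f - D₂ c := by rw [he₂]; ring
      rw [h]
      exact Ideal.sub_mem _ (Ideal.mem_sup_left (hmem _ (by simp))) (Ideal.mem_sup_right hD₂c)
    · have h : l₂ = D₁ f - D₁ c := by rw [he₁]; ring
      rw [h]
      exact Ideal.sub_mem _ (Ideal.mem_sup_left (hmem _ (by simp))) (Ideal.mem_sup_right hD₁c)
  have hle : maximalIdeal R ≤ N ⊔ maximalIdeal R • maximalIdeal R := by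
    rw [Ideal.smul_eq_mul, ← pow_two]
    exact hspan ▸ hgen
  refine le_antisymm hNle ?_
  exact Submodule.le_of_le_smul_of_le_jacobson_bot (IsNoetherian.noetherian _)
    (IsLocalRing.maximalIdeal_le_jacobson ⊥) hle

/-- **(C2) The Jacobian pair is part of a regular system of parameters** when `dim R = 4`: `IsRsopPart ![D₁ f, D₂ f]` (the tree's
predicate: `R` regular, `dim R = 2 + 2`, and `(D₁ f, D₂ f) ∪ (l₃, l₄)` generates `𝔪`). OURS. [cite: Matsumura1987, Thm. 14.2]
[folklore] -/
theorem isRsopPart_jacobianPair (hdim : ringKrullDim R = (4 : ℕ)) (f g l₁ l₂ l₃ l₄ c : R)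
    (hf : f - g ^ 2 = l₁ * l₂ + c) (hc : c ∈ maximalIdeal R ^ 3) (hspan : Ideal.span {l₁, l₂, l₃, l₄} = maximalIdeal R)
    (D₁ D₂ : Derivation ℤ R R) (h11 : D₁ l₁ = 1) (h12 : D₁ l₂ = 0) (h21 : D₂ l₁ = 0) (h22 : D₂ l₂ = 1) :
    IsRsopPart ![D₁ f, D₂ f] := by
  refine ⟨inferInstance, 2, ![l₃, l₄], hdim, ?_⟩
  rw [← span_jacobianPair_eq_maximalIdeal f g l₁ l₂ l₃ l₄ c hf hc hspan D₁ D₂ h11 h12 h21 h22]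
  congr 1
  ext x
  simp only [Set.mem_union, Set.mem_range, Set.mem_insert_iff, Set.mem_singleton_iff]
  constructor
  · rintro (⟨i, rfl⟩ | ⟨i, rfl⟩) <;> fin_cases i <;> simp
  · rintro (rfl | rfl | rfl | rfl)
    · exact Or.inl ⟨0, rfl⟩
    · exact Or.inl ⟨1, rfl⟩
    · exact Or.inr ⟨0, rfl⟩
    · exact Or.inr ⟨1, rfl⟩

omit [IsRegularLocalRing R] [CharP R 2] in
/-- The span of the pair as the span of a `Fin 2`-range. [folklore] -/
theorem span_range_pair (a b : R) : Ideal.span (Set.range ![a, b]) = Ideal.span {a, b} := by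
  congr 1
  ext x
  simp only [Set.mem_range, Set.mem_insert_iff, Set.mem_singleton_iff]
  constructor
  · rintro ⟨i, rfl⟩; fin_cases i <;> simp
  · rintro (rfl | rfl)
    · exact ⟨0, rfl⟩
    · exact ⟨1, rfl⟩

/-- **(C2, second clause) The critical surface**: with `dim R = 4`, `P₀ := (D₁ f, D₂ f)` is a PRIME of height `2` with `R ⧸ P₀` a
regular local ring (the regular surface germ Σ₂), and every prime `Q ∋ D₁ f, D₂ f` of height `≤ 2` EQUALS `P₀`. OURS.
[cite: Matsumura1987, Thm. 14.2] [folklore] -/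
theorem criticalSurface (hdim : ringKrullDim R = (4 : ℕ)) (f g l₁ l₂ l₃ l₄ c : R)
    (hf : f - g ^ 2 = l₁ * l₂ + c) (hc : c ∈ maximalIdeal R ^ 3) (hspan : Ideal.span {l₁, l₂, l₃, l₄} = maximalIdeal R)
    (D₁ D₂ : Derivation ℤ R R) (h11 : D₁ l₁ = 1) (h12 : D₁ l₂ = 0) (h21 : D₂ l₁ = 0) (h22 : D₂ l₂ = 1) :
    (Ideal.span {D₁ f, D₂ f}).IsPrime ∧ (Ideal.span {D₁ f, D₂ f}).height = 2 ∧
      IsRegularLocalRing (R ⧸ Ideal.span {D₁ f, D₂ f}) ∧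
      ∀ (Q : Ideal R), Q.IsPrime → D₁ f ∈ Q → D₂ f ∈ Q → Q.height ≤ 2 → Q = Ideal.span {D₁ f, D₂ f} := by
  have hz := isRsopPart_jacobianPair hdim f g l₁ l₂ l₃ l₄ c hf hc hspan D₁ D₂ h11 h12 h21 h22
  have hsp : Ideal.span (Set.range ![D₁ f, D₂ f]) = Ideal.span {D₁ f, D₂ f} := span_range_pair _ _
  have hprime : (Ideal.span {D₁ f, D₂ f}).IsPrime := hsp ▸ hz.isPrime_span_range
  have hht : (Ideal.span {D₁ f, D₂ f}).height = 2 := by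
    have h := hz.height_span_range
    rw [hsp] at h
    exact_mod_cast h
  have hreg : IsRegularLocalRing (R ⧸ Ideal.span {D₁ f, D₂ f}) := hsp ▸ hz.isRegularLocalRing_quotient
  refine ⟨hprime, hht, hreg, fun Q hQ h₁ h₂ hQ2 => ?_⟩
  have hle : Ideal.span {D₁ f, D₂ f} ≤ Q := by
    rw [Ideal.span_le]
    simp only [Set.insert_subset_iff, Set.singleton_subset_iff, SetLike.mem_coe]
    exact ⟨h₁, h₂⟩
  by_contra hne
  have hlt : Ideal.span {D₁ f, D₂ f} < Q := lt_of_le_of_ne hle (Ne.symm hne)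
  haveI := hprime
  haveI := hQ
  haveI : Q.FiniteHeight := Q.finiteHeight_iff.mpr (Or.inr (by
    exact ne_top_of_le_ne_top (by decide) hQ2))
  have h := Ideal.height_strict_mono_of_isPrime_of_isPrime hlt
  rw [hht] at h
  exact absurd hQ2 (not_le.mpr h)

end JacobianPair

/-! ## (C3) The low-stage dichotomy: carriers are curves on the critical surface, or the critical surface is permissible -/

section LowStageDichotomy

variable {K : Type} [Field K] [CharP K 2]

/-- **(C3) Low-stage dichotomy** (res-L0-w41-idea-3's `LowStageDichotomy`, `SingAt` UNFOLDED, with `dim R = 4`): at a LOW-SHAPE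
stage `f − g² = l₁ l₂ + c` (`c ∈ 𝔪³`, `(l₁, l₂, l₃, l₄) = 𝔪`, dual derivations `D₁, D₂` available) over a regular local subring
`R ⊆ K` of dimension `4` and characteristic `2`, EITHER every singular prime `Q ≠ 𝔪` of the torsor `T² = f` has height `3`
(all carriers through the centre are CURVES, lying on the critical surface Σ₂ = V(D₁ f, D₂ f) by (C1)), OR the generic point
`P₀ = (D₁ f, D₂ f)` of Σ₂ is itself singular: a prime of height `2` with `R ⧸ P₀` regular, contained in every singular prime —
the σ_top-PERMISSIBLE surface centre of res-type-082's `isPermissibleCentre_two_iff` (p505361), so the stage is NOT a point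
step. Proof: (C1) puts every singular prime above `P₀`; by (C2) a singular prime of height `≤ 2` IS `P₀`; a singular prime
strictly between `P₀` (height `2`) and `𝔪` (height `4`) has height `3`. OURS. [cite: Matsumura1987, Thm. 14.2] [folklore] -/
theorem lowStageDichotomy (R : Subring K) [IsRegularLocalRing R] (hdim : ringKrullDim R = (4 : ℕ))
    (f g l₁ l₂ l₃ l₄ c : R) (hf : f - g ^ 2 = l₁ * l₂ + c) (hc : c ∈ maximalIdeal R ^ 3)
    (hspan : Ideal.span {l₁, l₂, l₃, l₄} = maximalIdeal R)
    (hD : ∃ D₁ D₂ : Derivation ℤ R R, D₁ l₁ = 1 ∧ D₁ l₂ = 0 ∧ D₂ l₁ = 0 ∧ D₂ l₂ = 1) :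
    (∀ (Q : Ideal R) [Q.IsPrime],
        ¬ IsRegularLocalRing (AdjoinRoot ((X : (Localization.AtPrime Q)[X]) ^ 2 -
          C (algebraMap R (Localization.AtPrime Q) f))) →
        Q ≠ maximalIdeal R → Q.height = 3) ∨
      (∃ (P : Ideal R) (_ : P.IsPrime), P.height = 2 ∧ IsRegularLocalRing (R ⧸ P) ∧
        ¬ IsRegularLocalRing (AdjoinRoot ((X : (Localization.AtPrime P)[X]) ^ 2 -
          C (algebraMap R (Localization.AtPrime P) f))) ∧
        ∀ (Q : Ideal R) [Q.IsPrime],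
          ¬ IsRegularLocalRing (AdjoinRoot ((X : (Localization.AtPrime Q)[X]) ^ 2 -
            C (algebraMap R (Localization.AtPrime Q) f))) → P ≤ Q) := by
  classical
  haveI : CharP R 2 := inferInstance
  obtain ⟨D₁, D₂, h11, h12, h21, h22⟩ := hD
  obtain ⟨hP0prime, hP0ht, hP0reg, huniq⟩ := criticalSurface hdim f g l₁ l₂ l₃ l₄ c hf hc hspan D₁ D₂ h11 h12 h21 h22
  set P₀ : Ideal R := Ideal.span {D₁ f, D₂ f} with hP₀
  -- (C1): every singular prime contains the Jacobian pair
  have hcont : ∀ (Q : Ideal R) [Q.IsPrime],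
      ¬ IsRegularLocalRing (AdjoinRoot ((X : (Localization.AtPrime Q)[X]) ^ 2 -
        C (algebraMap R (Localization.AtPrime Q) f))) → P₀ ≤ Q := by
    intro Q _ hQ
    rw [hP₀, Ideal.span_le]
    simp only [Set.insert_subset_iff, Set.singleton_subset_iff, SetLike.mem_coe]
    exact ⟨derivation_apply_mem_of_singular R f Q hQ D₁, derivation_apply_mem_of_singular R f Q hQ D₂⟩
  haveI := hP0prime
  by_cases hP : ¬ IsRegularLocalRing (AdjoinRoot ((X : (Localization.AtPrime P₀)[X]) ^ 2 -
      C (algebraMap R (Localization.AtPrime P₀) f)))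
  · exact Or.inr ⟨P₀, hP0prime, hP0ht, hP0reg, hP, fun Q _ hQ => hcont Q hQ⟩
  · refine Or.inl fun Q _ hQ hne => ?_
    have hle : P₀ ≤ Q := hcont Q hQ
    have hneP : P₀ ≠ Q := by
      rintro rfl
      exact hP hQ
    -- `2 < height Q < 4`
    have hgt : (2 : ℕ∞) < Q.height := by
      rw [← hP0ht]
      exact Ideal.height_strict_mono_of_isPrime_of_isPrime (lt_of_le_of_ne hle hneP)
    have hlt : Q.height < (4 : ℕ) := by
      have hm : (maximalIdeal R).height = (4 : ℕ) := by
        have h := IsLocalRing.maximalIdeal_height_eq_ringKrullDim (R := R)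
        rw [hdim, ← WithBot.coe_natCast, WithBot.coe_eq_coe] at h
        exact h
      rw [← hm]
      exact Ideal.height_strict_mono_of_isPrime_of_isPrime
        (lt_of_le_of_ne (IsLocalRing.le_maximalIdeal (Ideal.IsPrime.ne_top inferInstance)) hne)
    -- hence `height Q = 3`
    have hfin : Q.height ≠ ⊤ := ne_top_of_lt hlt
    obtain ⟨n, hn⟩ := ENat.ne_top_iff_exists.mp hfin
    rw [← hn] at hgt hlt ⊢
    have h2 : 2 < n := by exact_mod_cast hgt
    have h4 : n < 4 := by exact_mod_cast hlt
    have h3 : n = 3 := by omega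
    rw [h3]; rfl

end LowStageDichotomy

end CriticalSurface

end Summit.ResolutionOfSingularities.ResolutionOfSingularities.Theorems.SwitchingDichotomy

end
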